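import Summits.KontsevichZagierPeriods.Zeta5Search.Certificates.RecordRayDenominatorsAtlas27Cells
import Summits.KontsevichZagierPeriods.Zeta5Search.A4WindowM48
import Summits.KontsevichZagierPeriods.Zeta5Search.A4WindowM52
import Summits.KontsevichZagierPeriods.Zeta5Search.A4WindowM56
import Summits.KontsevichZagierPeriods.Zeta5Search.L5ShapeM48
import Summits.KontsevichZagierPeriods.Zeta5Search.L5ShapeM56
import Summits.KontsevichZagierPeriods.Zeta5Search.RecShapesM52Proof
import Summits.KontsevichZagierPeriods.Zeta5Search.ZeroWindowM8
import Summits.KontsevichZagierPeriods.Zeta5Search.ZeroWindowM8Layer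
import Summits.KontsevichZagierPeriods.Zeta5Search.ZeroWindowM14
import Summits.KontsevichZagierPeriods.Zeta5Search.ZeroWindowM14Layer
import HarnessLib

/-!
# ζ(5) search — the record ray's DENOMINATORS, X-c: the 33-window tables and the eight FREE-STEP window lemmas (p3 g5)

HONEST FRAMING: systematic search; no irrationality claim unless certified.

OUR work (Summit side; prover seat p3, generation 5; continuation of typer g15's files V–X-b, census g27 KERNEL-LEDGER §5
"three free steps": cells that are ALREADY THEOREMS of the tree but were not consumed by the 27-window atlas).
Tables `AZv, BZv, wQv : Fin 33 → ℕ` (endpoints × 79560 = 17·4680, exponents): the 27 windows of file X-a (two of them with a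
raised exponent) and seven new windows —

* `(17n/18, 25n/26]⁵` from `SecondResidueLaw.RecWindowL5M56` (`L5ShapeM56.recWindowL5M56_holds`, `v_p(Cas₇) ≥ −104`) and
  `(25n/26, (79560−1)n/79560]⁴` from `RecordWindowsA4.RecWindowM56` (`A4WindowM56.recWindowM56_holds`, `≥ −105`) — windows BELOW
  `θ = 1`: there `p ∤ n` (a multiple of `p` strictly between `p` and `2p` is impossible), so the partner normaliser
  `N♯(bRecord′ n)` has the same valuation as on the ray (`padicValRat_sharpNormaliser_bRecord'_of_not_dvd`); the prime
  `p = n` itself is NOT claimed (the partner drops by two there), hence the right endpoint `(79560−1)/79560`;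
* `(n, 25n/24]⁵` (`SecondResidueLaw.RecWindowL5M52`, `LongClass.recWindowL5M52_holds`, `≥ −96`), `(25n/24, 18n/17]⁴`
  (`RecordWindowsA4.RecWindowM52`, `A4WindowM52.recWindowM52_holds`, `≥ −97`), `(11n/10, 10n/9]⁴` (`RecWindowM48`,
  `A4WindowM48.recWindowM48_holds`, `≥ −89`), `(10n/9, 9n/8]⁵` (`RecWindowL5M48`, `L5ShapeM48.recWindowL5M48_holds`, `≥ −88`);
* `(41n/10, 25n/6]` exponent `8 → 9` and `(41n/5, 25n/3]` exponent `6 → 7`: `ResidueLaw.RecWindowM14` / `RecWindowM8`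
  (`41n + 3 ≤ 10p` / `≤ 5p`) together with their PROVED boundary layers `RecWindowM14Layer` / `RecWindowM8Layer`
  (`10p ≤ 41n + 2` / `5p ≤ 41n + 2`) cover every prime of the window (two-case split), `≥ −22` / `≥ −10`.

All through `cell_core` (file V) exactly as in files VI-a/b/c/X-a; window lemmas at `n ≥ 47` (so that `p² > 41n + 2` for
`p > 17n/18`).  Rate `Σ k_i(B_i − A_i) = 21192947 / 79560` (`= 266.3769`; atlas27: `414253/1560 = 265.5468`).  File X-d assembles the
exponent.  Valuation bookkeeping only; every exponent `γ < 1` — no irrationality content.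
-/

noncomputable section

open Finset Real Filter Topology

namespace Summit.KontsevichZagierPeriods.Zeta5Search.RecordRay

open Summit.KontsevichZagierPeriods.Zeta5Search.DualSeries
open Summit.KontsevichZagierPeriods.Zeta5Search.DualSeriesDenominators
open Summit.KontsevichZagierPeriods.Zeta5Search.WedgeDictionary
open Summit.KontsevichZagierPeriods.Zeta5Search.DualSeriesLemma19 (bRecord)
open Summit.KontsevichZagierPeriods.Zeta5Search.CasoratianValuation (casoratian shift)

/-! ### The partner normaliser below `θ = 1` -/

section Partner

variable {n p : ℕ}

/-- `v_p(N(bRecord' n))` for a prime `p ∤ n`, `p > 14`, `15n < p²`, `n ≥ 1`: the same integer parts as on the ray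
(`p ∤ 13n`, `p ∤ 14n`, so `⌊(13n−1)/p⌋ = ⌊13n/p⌋`, `⌊(14n−1)/p⌋ = ⌊14n/p⌋`).  Variant of `padicValRat_normaliser_bRecord'`
(which asks `n < p`) for windows below `θ = 1`. -/
theorem padicValRat_normaliser_bRecord'_of_not_dvd (hn : 1 ≤ n) (hp : p.Prime) (hnd : ¬ p ∣ n) (hp14 : 14 < p)
    (hsq : 15 * n < p ^ 2) :
    padicValRat p ((normaliser (bRecord' n) : ℕ) : ℚ) =
      ((12 * n / p + 13 * n / p + 14 * n / p + 15 * n / p + 14 * n / p + 13 * n / p : ℕ) : ℤ) := by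
  haveI := Fact.mk hp
  have hF : ∀ m : ℕ, ((m.factorial : ℕ) : ℚ) ≠ 0 := fun m => by exact_mod_cast (Nat.factorial_pos m).ne'
  have h13 : ¬ p ∣ 13 * n := by
    intro h
    rcases (Nat.Prime.dvd_mul hp).1 h with h' | h'
    · exact absurd (Nat.le_of_dvd (by norm_num) h') (by omega)
    · exact hnd h'
  have h14 : ¬ p ∣ 14 * n := by
    intro h
    rcases (Nat.Prime.dvd_mul hp).1 h with h' | h'
    · exact absurd (Nat.le_of_dvd (by norm_num) h') (by omega)
    · exact hnd h'
  have e13 : (13 * n - 1) / p = 13 * n / p := pred_div_eq hp.pos (by omega) h13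
  have e14 : (14 * n - 1) / p = 14 * n / p := pred_div_eq hp.pos (by omega) h14
  rw [normaliser_bRecord']
  simp only [Nat.cast_mul]
  rw [padicValRat.mul (by simp [hF]) (hF _), padicValRat.mul (by simp [hF]) (hF _), padicValRat.mul (by simp [hF]) (hF _),
    padicValRat.mul (by simp [hF]) (hF _), padicValRat.mul (hF _) (hF _),
    padicValRat_factorial_eq_div (show 12 * n < p ^ 2 by omega), padicValRat_factorial_eq_div (show 13 * n - 1 < p ^ 2 by omega),
    padicValRat_factorial_eq_div (show 14 * n - 1 < p ^ 2 by omega), padicValRat_factorial_eq_div (show 15 * n < p ^ 2 by omega),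
    padicValRat_factorial_eq_div (show 14 * n < p ^ 2 by omega), padicValRat_factorial_eq_div (show 13 * n < p ^ 2 by omega),
    e13, e14]
  simp only [Nat.cast_add]

/-- `v_p(N♯(bRecord' n))` for `p ∤ n`, `p > 14`, `16n < p²`: the ray's value (variant of `padicValRat_sharpNormaliser_bRecord'`). -/
theorem padicValRat_sharpNormaliser_bRecord'_of_not_dvd (hn : 1 ≤ n) (hp : p.Prime) (hnd : ¬ p ∣ n) (hp14 : 14 < p)
    (hsq : 16 * n < p ^ 2) :
    padicValRat p (sharpNormaliser (bRecord' n)) =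
      ((12 * n / p + 13 * n / p + 14 * n / p + 15 * n / p + 14 * n / p + 13 * n / p : ℕ) : ℤ)
        - ((16 * n / p : ℕ) : ℤ) - ((15 * n / p : ℕ) : ℤ) := by
  haveI := Fact.mk hp
  have hF : ∀ m : ℕ, ((m.factorial : ℕ) : ℚ) ≠ 0 := fun m => by exact_mod_cast (Nat.factorial_pos m).ne'
  have hN : ((normaliser (bRecord' n) : ℕ) : ℚ) ≠ 0 := by
    have : 0 < normaliser (bRecord' n) := by unfold normaliser; exact prod_pos fun s _ => Nat.factorial_pos _
    exact_mod_cast this.ne'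
  unfold sharpNormaliser
  rw [bn_bRecord'_slot n (by norm_num) (by norm_num), bn_bRecord'_slot n (by norm_num) (by norm_num),
    padicValRat.div hN (mul_ne_zero (hF _) (hF _)), padicValRat.mul (hF _) (hF _),
    padicValRat_normaliser_bRecord'_of_not_dvd hn hp hnd hp14 (by omega), padicValRat_factorial_eq_div (by omega),
    padicValRat_factorial_eq_div (by omega)]
  norm_num
  ring

/-- A prime of a window `(A·n, B·n]` with `1/2 ≤ A` and `B < 1` (integer form: `a₁n < a₂p`, `b₂p ≤ b₁n`, `a₂ ≤ 2a₁`, `b₁ < b₂`)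
does not divide `n ≥ 1`: `n = p·q` would force `1 < q < 2`. -/
theorem not_dvd_of_window {a₁ a₂ b₁ b₂ : ℕ} (hp : p.Prime) (hn : 1 ≤ n) (hlo : a₁ * n < a₂ * p) (hhi : b₂ * p ≤ b₁ * n)
    (ha : a₂ ≤ 2 * a₁) (hb : b₁ < b₂) : ¬ p ∣ n := by
  rintro ⟨q, rfl⟩
  have hp0 := hp.pos
  have h1 : a₁ * q < a₂ := by
    have : p * (a₁ * q) < p * a₂ := by
      calc p * (a₁ * q) = a₁ * (p * q) := by ring
        _ < a₂ * p := hlo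
        _ = p * a₂ := by ring
    exact Nat.lt_of_mul_lt_mul_left this
  have h2 : b₂ ≤ b₁ * q := by
    have : p * b₂ ≤ p * (b₁ * q) := by
      calc p * b₂ = b₂ * p := by ring
        _ ≤ b₁ * (p * q) := hhi
        _ = p * (b₁ * q) := by ring
    exact Nat.le_of_mul_le_mul_left this hp0
  rcases Nat.lt_or_ge q 2 with hq | hq
  · have : b₁ * q ≤ b₁ * 1 := Nat.mul_le_mul_left _ (by omega)
    omega
  · have : a₁ * 2 ≤ a₁ * q := Nat.mul_le_mul_left _ hq
    omega

/-- Below `θ = 1` the side condition `41n + 2 < p²` of the A4/L5 windows holds for `p > 17n/18` once `n ≥ 47`. -/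
theorem sq_of_window_lt1 (hn : 47 ≤ n) (hlo : 17 * n < 18 * p) : 41 * n + 2 < p ^ 2 := by
  nlinarith [Nat.mul_lt_mul_of_lt_of_lt hlo hlo]

end Partner

/-! ### The 33-window tables (units `1/79560`) -/

/-- Left endpoints of the 33 windows, times `79560` (window `i` is `(AZv i/79560 · n, BZv i/79560 · n]`). -/
def AZv : Fin 33 → ℕ := ![1272960, 1352520, 1432080, 1989000, 150280, 159120, 238680, 318240, 326196, 331500, 358020, 371280, 397800, 437580, 450840, 477360, 497250, 636480, 652392, 663000, 954720, 1113840, 676260, 556920, 994500, 1034280, 1193400, 75140, 76500, 79560, 82875, 87516, 88400]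

/-- Right endpoints of the 33 windows, times `79560`. -/
def BZv : Fin 33 → ℕ := ![1352520, 1432080, 1989000, 3261960, 153000, 165750, 248625, 326196, 331500, 338130, 371280, 397800, 424320, 450840, 477360, 497250, 503880, 652392, 663000, 676260, 994500, 1193400, 716040, 596700, 1034280, 1113840, 1272960, 76500, 79559, 82875, 84240, 88400, 89505]

/-- Exponents removed on the 33 windows. -/
def wQv : Fin 33 → ℕ := ![8, 9, 10, 9, 6, 7, 7, 9, 9, 8, 7, 4, 5, 9, 9, 9, 8, 7, 7, 6, 9, 3, 5, 3, 1, 1, 3, 5, 4, 5, 4, 4, 5]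

/-- Left endpoints as reals. -/
def AwinV (i : Fin 33) : ℝ := (AZv i : ℝ) / 79560

/-- Right endpoints as reals. -/
def BwinV (i : Fin 33) : ℝ := (BZv i : ℝ) / 79560

/-! ### The free-step window lemmas (first part; the rest in file X-c2) -/

section Windows

variable {n p : ℕ}

/-- FREE-STEP window `(17/18n, 25/26n]` (table units `1/79560`: `(75140, 76500]`): `RecWindowL5M56` (`-104 ≤ v_p(Cas₇)`, PROVED in the tree),
`v_p(N♯) = 50`, `v_p(ρ) = 100`, exponent `5`; `θ < 1`: the partner normaliser through `p ∤ n`; the integer part `⌊18n/p⌋` changes at `θ = 18/19` inside the window (two cases, same exponent). -/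
theorem wFree0 {n p : ℕ} (hn : 47 ≤ n) (hp : p.Prime) (hlo : 75140 * n < 79560 * p) (hhi : 79560 * p ≤ 76500 * n)
    {zW zV zW' zV' zU zU' : ℤ}
    (hzW : dRec n ^ 3 * sharpNormaliser (bRecord n) * coeffW (bRecord n) = zW)
    (hzV : dRec n ^ 6 * sharpNormaliser (bRecord n) * coeffV (bRecord n) = zV)
    (hzW' : dRec n ^ 3 * sharpNormaliser (bRecord' n) * coeffW (bRecord' n) = zW')
    (hzV' : dRec n ^ 6 * sharpNormaliser (bRecord' n) * coeffV (bRecord' n) = zV')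
    (hzU : dRec n * sharpNormaliser (bRecord n) * coeffU (bRecord n) = zU)
    (hzU' : dRec n * sharpNormaliser (bRecord' n) * coeffU (bRecord' n) = zU') :
    (p : ℤ) ^ 5 ∣ (zW' * zV - zW * zV') ∧
    (p : ℤ) ^ 5 ∣ ((Nat.lcmUpto (41 * n) : ℤ) ^ 5 * (zU * zW') - (Nat.lcmUpto (41 * n) : ℤ) ^ 5 * (zU' * zW)) := by
  have hloN : 17 * n < 18 * p := by omega
  have hhiN' : 26 * p ≤ 25 * n := by omega
  have hn1 : 1 ≤ n := by omega
  have hp41 : p ≤ 41 * n := by omega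
  have h1718 : 17 * n < 18 * p := by omega
  have hsq2 : 41 * n + 2 < p ^ 2 := sq_of_window_lt1 hn h1718
  have hsq : 41 * n < p ^ 2 := by omega
  have hnd : ¬ p ∣ n := not_dvd_of_window hp hn1 hloN hhiN' (by norm_num) (by norm_num)
  have hhiN : 26 * p ≤ 25 * n := hhiN'
  have hcas : casoratian (bRecord n) 7 ≠ 0 → (-104 : ℤ) ≤ padicValRat p (casoratian (bRecord n) 7) := by
    intro hne
    rw [bRecord_eq_bRec] at hne ⊢
    exact L5ShapeM56.recWindowL5M56_holds n p (by omega) hp hloN hhiN hsq2 hne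
  rcases le_or_gt (19 * p) (18 * n) with hmid | hmid
  · -- θ ≤ 18/19
    have e8 : 8 * n / p = 8 := Nat.div_eq_of_lt_le (by omega) (by omega)
    have e9 : 9 * n / p = 9 := Nat.div_eq_of_lt_le (by omega) (by omega)
    have e10 : 10 * n / p = 10 := Nat.div_eq_of_lt_le (by omega) (by omega)
    have e11 : 11 * n / p = 11 := Nat.div_eq_of_lt_le (by omega) (by omega)
    have e12 : 12 * n / p = 12 := Nat.div_eq_of_lt_le (by omega) (by omega)
    have e13 : 13 * n / p = 13 := Nat.div_eq_of_lt_le (by omega) (by omega)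
    have e14 : 14 * n / p = 14 := Nat.div_eq_of_lt_le (by omega) (by omega)
    have e15 : 15 * n / p = 15 := Nat.div_eq_of_lt_le (by omega) (by omega)
    have e16 : 16 * n / p = 16 := Nat.div_eq_of_lt_le (by omega) (by omega)
    have e17 : 17 * n / p = 17 := Nat.div_eq_of_lt_le (by omega) (by omega)
    have e18 : 18 * n / p = 19 := Nat.div_eq_of_lt_le (by omega) (by omega)
    have e25 : 25 * n / p = 26 := Nat.div_eq_of_lt_le (by omega) (by omega)
    have hvN : padicValRat p (sharpNormaliser (bRecord n)) = 50 := by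
      rw [padicValRat_sharpNormaliser_bRecord hp (by omega), e12, e13, e14, e15, e16]; norm_num
    have hvN' : padicValRat p (sharpNormaliser (bRecord' n)) = 50 := by
      rw [padicValRat_sharpNormaliser_bRecord'_of_not_dvd hn1 hp hnd (by omega) (by omega), e12, e13, e14, e15, e16]; norm_num
    have hvr : padicValRat p (rhoOf (aRec n)) = 100 := by
      rw [padicValRat_rhoOf_aRec hp (by omega) (by omega), e8, e9, e10, e11, e12, e13, e14, e15, e16, e17, e18, e25]
      norm_num
    exact cell_core hn1 hp hp41 hsq hvN hvN' hvr hcas (k := 5) (by norm_num) (by norm_num) hzW hzV hzW' hzV' hzU hzU'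
  · -- θ > 18/19
    have e8 : 8 * n / p = 8 := Nat.div_eq_of_lt_le (by omega) (by omega)
    have e9 : 9 * n / p = 9 := Nat.div_eq_of_lt_le (by omega) (by omega)
    have e10 : 10 * n / p = 10 := Nat.div_eq_of_lt_le (by omega) (by omega)
    have e11 : 11 * n / p = 11 := Nat.div_eq_of_lt_le (by omega) (by omega)
    have e12 : 12 * n / p = 12 := Nat.div_eq_of_lt_le (by omega) (by omega)
    have e13 : 13 * n / p = 13 := Nat.div_eq_of_lt_le (by omega) (by omega)
    have e14 : 14 * n / p = 14 := Nat.div_eq_of_lt_le (by omega) (by omega)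
    have e15 : 15 * n / p = 15 := Nat.div_eq_of_lt_le (by omega) (by omega)
    have e16 : 16 * n / p = 16 := Nat.div_eq_of_lt_le (by omega) (by omega)
    have e17 : 17 * n / p = 17 := Nat.div_eq_of_lt_le (by omega) (by omega)
    have e18 : 18 * n / p = 18 := Nat.div_eq_of_lt_le (by omega) (by omega)
    have e25 : 25 * n / p = 26 := Nat.div_eq_of_lt_le (by omega) (by omega)
    have hvN : padicValRat p (sharpNormaliser (bRecord n)) = 50 := by
      rw [padicValRat_sharpNormaliser_bRecord hp (by omega), e12, e13, e14, e15, e16]; norm_num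
    have hvN' : padicValRat p (sharpNormaliser (bRecord' n)) = 50 := by
      rw [padicValRat_sharpNormaliser_bRecord'_of_not_dvd hn1 hp hnd (by omega) (by omega), e12, e13, e14, e15, e16]; norm_num
    have hvr : padicValRat p (rhoOf (aRec n)) = 99 := by
      rw [padicValRat_rhoOf_aRec hp (by omega) (by omega), e8, e9, e10, e11, e12, e13, e14, e15, e16, e17, e18, e25]
      norm_num
    exact cell_core hn1 hp hp41 hsq hvN hvN' hvr hcas (k := 5) (by norm_num) (by norm_num) hzW hzV hzW' hzV' hzU hzU'

/-- FREE-STEP window `(25/26n, 79559/79560n]` (table units `1/79560`: `(76500, 79559]`): `RecWindowM56` (`-105 ≤ v_p(Cas₇)`, PROVED in the tree),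
`v_p(N♯) = 50`, `v_p(ρ) = 100`, exponent `4`; `θ < 1`: the partner normaliser through `p ∤ n`. -/
theorem wFree1 {n p : ℕ} (hn : 47 ≤ n) (hp : p.Prime) (hlo : 76500 * n < 79560 * p) (hhi : 79560 * p ≤ 79559 * n)
    {zW zV zW' zV' zU zU' : ℤ}
    (hzW : dRec n ^ 3 * sharpNormaliser (bRecord n) * coeffW (bRecord n) = zW)
    (hzV : dRec n ^ 6 * sharpNormaliser (bRecord n) * coeffV (bRecord n) = zV)
    (hzW' : dRec n ^ 3 * sharpNormaliser (bRecord' n) * coeffW (bRecord' n) = zW')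
    (hzV' : dRec n ^ 6 * sharpNormaliser (bRecord' n) * coeffV (bRecord' n) = zV')
    (hzU : dRec n * sharpNormaliser (bRecord n) * coeffU (bRecord n) = zU)
    (hzU' : dRec n * sharpNormaliser (bRecord' n) * coeffU (bRecord' n) = zU') :
    (p : ℤ) ^ 4 ∣ (zW' * zV - zW * zV') ∧
    (p : ℤ) ^ 4 ∣ ((Nat.lcmUpto (41 * n) : ℤ) ^ 5 * (zU * zW') - (Nat.lcmUpto (41 * n) : ℤ) ^ 5 * (zU' * zW)) := by
  have hloN : 25 * n < 26 * p := by omega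
  have hhiN' : 79560 * p ≤ 79559 * n := by omega
  have hn1 : 1 ≤ n := by omega
  have hp41 : p ≤ 41 * n := by omega
  have h1718 : 17 * n < 18 * p := by omega
  have hsq2 : 41 * n + 2 < p ^ 2 := sq_of_window_lt1 hn h1718
  have hsq : 41 * n < p ^ 2 := by omega
  have hnd : ¬ p ∣ n := not_dvd_of_window hp hn1 hloN hhiN' (by norm_num) (by norm_num)
  have hhiN : 79560 * p ≤ 79559 * n := hhiN'
  have hcas : casoratian (bRecord n) 7 ≠ 0 → (-105 : ℤ) ≤ padicValRat p (casoratian (bRecord n) 7) := by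
    intro hne
    rw [bRecord_eq_bRec] at hne ⊢
    exact A4WindowM56.recWindowM56_holds n p (by omega) hp (by omega) (by omega) hsq2 hne
  have e8 : 8 * n / p = 8 := Nat.div_eq_of_lt_le (by omega) (by omega)
  have e9 : 9 * n / p = 9 := Nat.div_eq_of_lt_le (by omega) (by omega)
  have e10 : 10 * n / p = 10 := Nat.div_eq_of_lt_le (by omega) (by omega)
  have e11 : 11 * n / p = 11 := Nat.div_eq_of_lt_le (by omega) (by omega)
  have e12 : 12 * n / p = 12 := Nat.div_eq_of_lt_le (by omega) (by omega)
  have e13 : 13 * n / p = 13 := Nat.div_eq_of_lt_le (by omega) (by omega)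
  have e14 : 14 * n / p = 14 := Nat.div_eq_of_lt_le (by omega) (by omega)
  have e15 : 15 * n / p = 15 := Nat.div_eq_of_lt_le (by omega) (by omega)
  have e16 : 16 * n / p = 16 := Nat.div_eq_of_lt_le (by omega) (by omega)
  have e17 : 17 * n / p = 17 := Nat.div_eq_of_lt_le (by omega) (by omega)
  have e18 : 18 * n / p = 18 := Nat.div_eq_of_lt_le (by omega) (by omega)
  have e25 : 25 * n / p = 25 := Nat.div_eq_of_lt_le (by omega) (by omega)
  have hvN : padicValRat p (sharpNormaliser (bRecord n)) = 50 := by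
    rw [padicValRat_sharpNormaliser_bRecord hp (by omega), e12, e13, e14, e15, e16]; norm_num
  have hvN' : padicValRat p (sharpNormaliser (bRecord' n)) = 50 := by
    rw [padicValRat_sharpNormaliser_bRecord'_of_not_dvd hn1 hp hnd (by omega) (by omega), e12, e13, e14, e15, e16]; norm_num
  have hvr : padicValRat p (rhoOf (aRec n)) = 100 := by
    rw [padicValRat_rhoOf_aRec hp (by omega) (by omega), e8, e9, e10, e11, e12, e13, e14, e15, e16, e17, e18, e25]
    norm_num
  exact cell_core hn1 hp hp41 hsq hvN hvN' hvr hcas (k := 4) (by norm_num) (by norm_num) hzW hzV hzW' hzV' hzU hzU'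

/-- FREE-STEP window `(1n, 25/24n]` (table units `1/79560`: `(79560, 82875]`): `RecWindowL5M52` (`-96 ≤ v_p(Cas₇)`, PROVED in the tree),
`v_p(N♯) = 46`, `v_p(ρ) = 91`, exponent `5`. -/
theorem wFree2 {n p : ℕ} (hn : 47 ≤ n) (hp : p.Prime) (hlo : 79560 * n < 79560 * p) (hhi : 79560 * p ≤ 82875 * n)
    {zW zV zW' zV' zU zU' : ℤ}
    (hzW : dRec n ^ 3 * sharpNormaliser (bRecord n) * coeffW (bRecord n) = zW)
    (hzV : dRec n ^ 6 * sharpNormaliser (bRecord n) * coeffV (bRecord n) = zV)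
    (hzW' : dRec n ^ 3 * sharpNormaliser (bRecord' n) * coeffW (bRecord' n) = zW')
    (hzV' : dRec n ^ 6 * sharpNormaliser (bRecord' n) * coeffV (bRecord' n) = zV')
    (hzU : dRec n * sharpNormaliser (bRecord n) * coeffU (bRecord n) = zU)
    (hzU' : dRec n * sharpNormaliser (bRecord' n) * coeffU (bRecord' n) = zU') :
    (p : ℤ) ^ 5 ∣ (zW' * zV - zW * zV') ∧
    (p : ℤ) ^ 5 ∣ ((Nat.lcmUpto (41 * n) : ℤ) ^ 5 * (zU * zW') - (Nat.lcmUpto (41 * n) : ℤ) ^ 5 * (zU' * zW)) := by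
  have hloN : 1 * n < 1 * p := by omega
  have hhiN' : 24 * p ≤ 25 * n := by omega
  have hn1 : 1 ≤ n := by omega
  have hp41 : p ≤ 41 * n := by omega
  have hnp : n < p := by omega
  have hsq2 : 41 * n + 2 < p ^ 2 := by nlinarith
  have hsq : 41 * n < p ^ 2 := by omega
  have hhiN : 24 * p ≤ 25 * n := hhiN'
  have hcas : casoratian (bRecord n) 7 ≠ 0 → (-96 : ℤ) ≤ padicValRat p (casoratian (bRecord n) 7) := by
    intro hne
    rw [bRecord_eq_bRec] at hne ⊢
    exact LongClass.recWindowL5M52_holds n p (by omega) hp (by omega) hhiN hsq2 hne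
  have e8 : 8 * n / p = 7 := Nat.div_eq_of_lt_le (by omega) (by omega)
  have e9 : 9 * n / p = 8 := Nat.div_eq_of_lt_le (by omega) (by omega)
  have e10 : 10 * n / p = 9 := Nat.div_eq_of_lt_le (by omega) (by omega)
  have e11 : 11 * n / p = 10 := Nat.div_eq_of_lt_le (by omega) (by omega)
  have e12 : 12 * n / p = 11 := Nat.div_eq_of_lt_le (by omega) (by omega)
  have e13 : 13 * n / p = 12 := Nat.div_eq_of_lt_le (by omega) (by omega)
  have e14 : 14 * n / p = 13 := Nat.div_eq_of_lt_le (by omega) (by omega)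
  have e15 : 15 * n / p = 14 := Nat.div_eq_of_lt_le (by omega) (by omega)
  have e16 : 16 * n / p = 15 := Nat.div_eq_of_lt_le (by omega) (by omega)
  have e17 : 17 * n / p = 16 := Nat.div_eq_of_lt_le (by omega) (by omega)
  have e18 : 18 * n / p = 17 := Nat.div_eq_of_lt_le (by omega) (by omega)
  have e25 : 25 * n / p = 24 := Nat.div_eq_of_lt_le (by omega) (by omega)
  have hvN : padicValRat p (sharpNormaliser (bRecord n)) = 46 := by
    rw [padicValRat_sharpNormaliser_bRecord hp (by omega), e12, e13, e14, e15, e16]; norm_num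
  have hvN' : padicValRat p (sharpNormaliser (bRecord' n)) = 46 := by
    rw [padicValRat_sharpNormaliser_bRecord' hn1 hp hnp (by omega) (by omega), e12, e13, e14, e15, e16]; norm_num
  have hvr : padicValRat p (rhoOf (aRec n)) = 91 := by
    rw [padicValRat_rhoOf_aRec hp (by omega) (by omega), e8, e9, e10, e11, e12, e13, e14, e15, e16, e17, e18, e25]
    norm_num
  exact cell_core hn1 hp hp41 hsq hvN hvN' hvr hcas (k := 5) (by norm_num) (by norm_num) hzW hzV hzW' hzV' hzU hzU'

end Windows

end Summit.KontsevichZagierPeriods.Zeta5Search.RecordRay
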